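import Summits.Ventures.PercRepro.C026ProdCSDefs

/-!
# THEOREM PROD ((CS) composition), Lemma B: the explicit decomposition (p5, gen 16)

mine-3's LEMMA B (`proofs/MINE3-PRODUCT.md` §1): a normalized generator `g ∈ K` with
`(u, v) ≠ (0, 0)` is a convex combination `g = (1 − λ)·id + λ·g′` of the identity `id = (1, 0, 0, 0, 0, 0)`
and a generator `g′ ∈ K` that is DOMINATED by an independent generator `e(a, b) ∈ E1`:
`u′ ≤ a`, `v′ ≤ b`, `ν′ ≤ ab`, `α′ ≥ a²`, `β′ ≥ b²`. Here `λ = max (u + v − ν, u²/α, v²/β)`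
(a quotient with zero denominator reads `0`, as in Lean), `g′ = (1 − (u + v − ν)/λ, ρ/λ, σ/λ, ν/λ,
α/λ, β/λ)`, `a = min (1, √(α/λ))`, `b = min (1, √(β/λ))`; `a + b ≥ 1` because `λ ≤ (√α + √β)²`.

* `lemmaB_bounds` — `0 < λ ≤ 1`, `ρ + σ + ν ≤ λ`, `u² ≤ αλ`, `v² ≤ βλ`;
* **`lemmaB`** — the decomposition with all its properties, packaged as one existential.
-/

namespace PercRepro

namespace ProdCS

open Gen

/-- `λ = max (u + v − ν) (max (u²/α) (v²/β))`. -/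
noncomputable def lam (g : Gen) : ℝ :=
  max (g.ρ + g.σ + g.ν) (max (g.u ^ 2 / g.α) (g.v ^ 2 / g.β))

/-- The bounds on `λ` for `g ∈ K` with `(u, v) ≠ (0, 0)`: `0 < λ ≤ 1`, `ρ + σ + ν ≤ λ`,
`u² ≤ αλ`, `v² ≤ βλ`. -/
theorem lemmaB_bounds {g : Gen} (hK : MemK g) (hne : 0 < g.u ∨ 0 < g.v) :
    0 < lam g ∧ lam g ≤ 1 ∧ g.ρ + g.σ + g.ν ≤ lam g ∧ g.u ^ 2 ≤ g.α * lam g ∧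
      g.v ^ 2 ≤ g.β * lam g := by
  have hρ := hK.ρ_nonneg; have hσ := hK.σ_nonneg; have hν := hK.ν_nonneg
  have hα := hK.α_nonneg; have hβ := hK.β_nonneg; have hζ := hK.ζ_nonneg
  have hnorm := hK.norm
  have h1 : g.ρ + g.σ + g.ν ≤ lam g := le_max_left _ _
  have h2 : g.u ^ 2 / g.α ≤ lam g := le_trans (le_max_left _ _) (le_max_right _ _)
  have h3 : g.v ^ 2 / g.β ≤ lam g := le_trans (le_max_right _ _) (le_max_right _ _)
  have hpos : 0 < lam g := by
    rcases hne with hu | hv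
    · unfold Gen.u at hu; linarith
    · unfold Gen.v at hv; linarith
  refine ⟨hpos, ?_, h1, ?_, ?_⟩
  · -- `λ ≤ 1`: each of the three terms is `≤ 1`
    refine max_le (by linarith) (max_le ?_ ?_)
    · rcases eq_or_lt_of_le hα with h0 | h0
      · rw [← h0, div_zero]; exact zero_le_one
      · exact (div_le_one h0).mpr hK.c4a
    · rcases eq_or_lt_of_le hβ with h0 | h0
      · rw [← h0, div_zero]; exact zero_le_one
      · exact (div_le_one h0).mpr hK.c4b
  · -- `u² ≤ αλ`
    rcases eq_or_lt_of_le hα with h0 | h0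
    · have : g.u ^ 2 ≤ 0 := by rw [h0]; exact hK.c4a
      nlinarith [sq_nonneg g.u]
    · have := (div_le_iff₀ h0).mp h2
      linarith
  · -- `v² ≤ βλ`
    rcases eq_or_lt_of_le hβ with h0 | h0
    · have : g.v ^ 2 ≤ 0 := by rw [h0]; exact hK.c4b
      nlinarith [sq_nonneg g.v]
    · have := (div_le_iff₀ h0).mp h3
      linarith

/-- **LEMMA B** (mine-3, `MINE3-PRODUCT.md` §1): a normalized `g ∈ K` with `(u, v) ≠ (0, 0)` is
`(1 − λ)·id + λ·g′` with `0 < λ ≤ 1`, `g′ ∈ K`, and `g′` dominated by an `E1` generator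
`e(a, b)`: `u′ ≤ a`, `v′ ≤ b`, `ν′ ≤ ab`, `a² ≤ α′`, `b² ≤ β′`, with `a, b ∈ [0, 1]`, `a + b ≥ 1`. -/
theorem lemmaB {g : Gen} (hK : MemK g) (hne : 0 < g.u ∨ 0 < g.v) :
    ∃ (l : ℝ) (g' : Gen) (a b : ℝ), 0 < l ∧ l ≤ 1 ∧ MemK g' ∧
      g.ζ = (1 - l) + l * g'.ζ ∧ g.ρ = l * g'.ρ ∧ g.σ = l * g'.σ ∧ g.ν = l * g'.ν ∧
      g.α = l * g'.α ∧ g.β = l * g'.β ∧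
      0 ≤ a ∧ a ≤ 1 ∧ 0 ≤ b ∧ b ≤ 1 ∧ 1 ≤ a + b ∧
      g'.u ≤ a ∧ g'.v ≤ b ∧ g'.ν ≤ a * b ∧ a ^ 2 ≤ g'.α ∧ b ^ 2 ≤ g'.β := by
  obtain ⟨hpos, hle1, hsum, hua, hvb⟩ := lemmaB_bounds hK hne
  generalize hl : lam g = l at hpos hle1 hsum hua hvb
  have hρ := hK.ρ_nonneg; have hσ := hK.σ_nonneg; have hν := hK.ν_nonneg
  have hα := hK.α_nonneg; have hβ := hK.β_nonneg; have hζ := hK.ζ_nonneg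
  have hnorm := hK.norm
  have hne' : l ≠ 0 := hpos.ne'
  have hu0 : 0 ≤ g.u := by unfold Gen.u; linarith
  have hv0 : 0 ≤ g.v := by unfold Gen.v; linarith
  have hl2 : 0 < l ^ 2 := by positivity
  have hαl : 0 ≤ g.α / l := div_nonneg hα hpos.le
  have hβl : 0 ≤ g.β / l := div_nonneg hβ hpos.le
  -- `a`, `b`
  obtain ⟨a, ha⟩ : ∃ a : ℝ, a = min 1 (Real.sqrt (g.α / l)) := ⟨_, rfl⟩
  obtain ⟨b, hb⟩ : ∃ b : ℝ, b = min 1 (Real.sqrt (g.β / l)) := ⟨_, rfl⟩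
  have ha0 : 0 ≤ a := ha ▸ le_min zero_le_one (Real.sqrt_nonneg _)
  have hb0 : 0 ≤ b := hb ▸ le_min zero_le_one (Real.sqrt_nonneg _)
  have ha1 : a ≤ 1 := ha ▸ min_le_left _ _
  have hb1 : b ≤ 1 := hb ▸ min_le_left _ _
  have hasq : a ^ 2 ≤ g.α / l := by
    calc a ^ 2 ≤ (Real.sqrt (g.α / l)) ^ 2 := pow_le_pow_left₀ ha0 (ha ▸ min_le_right _ _) 2
      _ = g.α / l := Real.sq_sqrt hαl
  have hbsq : b ^ 2 ≤ g.β / l := by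
    calc b ^ 2 ≤ (Real.sqrt (g.β / l)) ^ 2 := pow_le_pow_left₀ hb0 (hb ▸ min_le_right _ _) 2
      _ = g.β / l := Real.sq_sqrt hβl
  -- `u/λ ≤ a`, `v/λ ≤ b`
  have hu_le : g.u / l ≤ a := by
    rw [ha]
    refine le_min ?_ ?_
    · rw [div_le_one hpos]; unfold Gen.u; linarith
    · rw [Real.le_sqrt (div_nonneg hu0 hpos.le) hαl, div_pow, div_le_div_iff₀ hl2 hpos]
      calc g.u ^ 2 * l ≤ g.α * l * l := mul_le_mul_of_nonneg_right hua hpos.le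
        _ = g.α * l ^ 2 := by ring
  have hv_le : g.v / l ≤ b := by
    rw [hb]
    refine le_min ?_ ?_
    · rw [div_le_one hpos]; unfold Gen.v; linarith
    · rw [Real.le_sqrt (div_nonneg hv0 hpos.le) hβl, div_pow, div_le_div_iff₀ hl2 hpos]
      calc g.v ^ 2 * l ≤ g.β * l * l := mul_le_mul_of_nonneg_right hvb hpos.le
        _ = g.β * l ^ 2 := by ring
  -- `ν/λ ≤ ab`
  have hν_le : g.ν / l ≤ a * b := by
    have hνl : 0 ≤ g.ν / l := div_nonneg hν hpos.le
    have hνu : g.ν ≤ g.u := by unfold Gen.u; linarith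
    have hνv : g.ν ≤ g.v := by unfold Gen.v; linarith
    have hc3 := hK.c3
    by_cases hA : Real.sqrt (g.α / l) ≤ 1 <;> by_cases hB : Real.sqrt (g.β / l) ≤ 1
    · rw [ha, hb, min_eq_right hA, min_eq_right hB, ← Real.sqrt_mul hαl,
        Real.le_sqrt hνl (mul_nonneg hαl hβl), div_pow, div_mul_div_comm,
        div_le_div_iff₀ hl2 (by positivity)]
      calc g.ν ^ 2 * (l * l) ≤ g.α * g.β * (l * l) :=
            mul_le_mul_of_nonneg_right hc3 (by positivity)
        _ = g.α * g.β * l ^ 2 := by ring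
    · push Not at hB
      rw [ha, hb, min_eq_right hA, min_eq_left hB.le, mul_one,
        Real.le_sqrt hνl hαl, div_pow, div_le_div_iff₀ hl2 hpos]
      have h1 : g.ν ^ 2 ≤ g.α * l := (pow_le_pow_left₀ hν hνu 2).trans hua
      calc g.ν ^ 2 * l ≤ g.α * l * l := mul_le_mul_of_nonneg_right h1 hpos.le
        _ = g.α * l ^ 2 := by ring
    · push Not at hA
      rw [ha, hb, min_eq_left hA.le, min_eq_right hB, one_mul,
        Real.le_sqrt hνl hβl, div_pow, div_le_div_iff₀ hl2 hpos]
      have h1 : g.ν ^ 2 ≤ g.β * l := (pow_le_pow_left₀ hν hνv 2).trans hvb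
      calc g.ν ^ 2 * l ≤ g.β * l * l := mul_le_mul_of_nonneg_right h1 hpos.le
        _ = g.β * l ^ 2 := by ring
    · push Not at hA hB
      rw [ha, hb, min_eq_left hA.le, min_eq_left hB.le, mul_one, div_le_one hpos]
      linarith
  -- `a + b ≥ 1`: otherwise `λ ≤ λ (a + b)² < λ`
  have hab : 1 ≤ a + b := by
    by_contra hcon
    push Not at hcon
    have hA : Real.sqrt (g.α / l) ≤ 1 := by
      by_contra h
      push Not at h
      have : a = 1 := by rw [ha, min_eq_left h.le]
      linarith
    have hB : Real.sqrt (g.β / l) ≤ 1 := by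
      by_contra h
      push Not at h
      have : b = 1 := by rw [hb, min_eq_left h.le]
      linarith
    have haeq : a ^ 2 = g.α / l := by rw [ha, min_eq_right hA]; exact Real.sq_sqrt hαl
    have hbeq : b ^ 2 = g.β / l := by rw [hb, min_eq_right hB]; exact Real.sq_sqrt hβl
    have hαe : g.α = l * a ^ 2 := by rw [haeq, mul_div_cancel₀ _ hne']
    have hβe : g.β = l * b ^ 2 := by rw [hbeq, mul_div_cancel₀ _ hne']
    -- `ν ≤ λab`, `ρ ≤ λa²`, `σ ≤ λb²`
    have hνab : g.ν ≤ l * (a * b) := by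
      have h3 := hK.c3
      rw [hαe, hβe] at h3
      have : g.ν ^ 2 ≤ (l * (a * b)) ^ 2 := by
        calc g.ν ^ 2 ≤ l * a ^ 2 * (l * b ^ 2) := h3
          _ = (l * (a * b)) ^ 2 := by ring
      exact (pow_le_pow_iff_left₀ hν (by positivity) two_ne_zero).mp this
    have hρa : g.ρ ≤ l * a ^ 2 := hαe ▸ hK.ρ_le
    have hσb : g.σ ≤ l * b ^ 2 := hβe ▸ hK.σ_le
    -- each of the three terms of `λ` is `≤ λ (a + b)²`
    have hsab : 0 ≤ a + b := by linarith
    have hlab : 0 ≤ l * (a * b) := mul_nonneg hpos.le (mul_nonneg ha0 hb0)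
    have hexp : l * (a + b) ^ 2 = l * a ^ 2 + l * b ^ 2 + 2 * (l * (a * b)) := by ring
    have hlt : l * (a + b) ^ 2 < l := by
      have : (a + b) ^ 2 < 1 := pow_lt_one₀ hsab hcon two_ne_zero
      exact mul_lt_of_lt_one_right hpos this
    have t1 : g.ρ + g.σ + g.ν ≤ l * (a + b) ^ 2 := by linarith
    have t2 : g.u ^ 2 / g.α ≤ l * (a + b) ^ 2 := by
      rcases eq_or_lt_of_le hα with h0 | h0
      · rw [← h0, div_zero]; positivity
      · rw [div_le_iff₀ h0]
        have hu_bound : g.u ≤ l * a * (a + b) := by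
          unfold Gen.u; linarith [show l * a * (a + b) = l * a ^ 2 + l * (a * b) by ring]
        calc g.u ^ 2 ≤ (l * a * (a + b)) ^ 2 := pow_le_pow_left₀ hu0 hu_bound 2
          _ = l * (a + b) ^ 2 * (l * a ^ 2) := by ring
          _ = l * (a + b) ^ 2 * g.α := by rw [hαe]
    have t3 : g.v ^ 2 / g.β ≤ l * (a + b) ^ 2 := by
      rcases eq_or_lt_of_le hβ with h0 | h0
      · rw [← h0, div_zero]; positivity
      · rw [div_le_iff₀ h0]
        have hv_bound : g.v ≤ l * b * (a + b) := by
          unfold Gen.v; linarith [show l * b * (a + b) = l * b ^ 2 + l * (a * b) by ring]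
        calc g.v ^ 2 ≤ (l * b * (a + b)) ^ 2 := pow_le_pow_left₀ hv0 hv_bound 2
          _ = l * (a + b) ^ 2 * (l * b ^ 2) := by ring
          _ = l * (a + b) ^ 2 * g.β := by rw [hβe]
    have : lam g ≤ l * (a + b) ^ 2 := max_le t1 (max_le t2 t3)
    rw [hl] at this
    linarith
  -- the generator `g′`
  obtain ⟨g', hg'⟩ : ∃ g' : Gen,
      g' = ⟨1 - (g.ρ + g.σ + g.ν) / l, g.ρ / l, g.σ / l, g.ν / l, g.α / l, g.β / l⟩ := ⟨_, rfl⟩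
  have hu' : g'.u = g.u / l := by rw [hg']; simp only [Gen.u]; ring
  have hv' : g'.v = g.v / l := by rw [hg']; simp only [Gen.v]; ring
  have hK' : MemK g' := by
    rw [hg']
    refine ⟨?_, div_nonneg hρ hpos.le, div_nonneg hσ hpos.le, div_nonneg hν hpos.le, hαl, hβl,
      ?_, ?_, ?_, ?_, ?_, ?_⟩
    · show 0 ≤ 1 - (g.ρ + g.σ + g.ν) / l
      rw [sub_nonneg, div_le_one hpos]; exact hsum
    · show 1 - (g.ρ + g.σ + g.ν) / l + g.ρ / l + g.σ / l + g.ν / l = 1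
      have : (g.ρ + g.σ + g.ν) / l = g.ρ / l + g.σ / l + g.ν / l := by rw [add_div, add_div]
      linarith
    · show g.ρ / l ≤ g.α / l
      exact div_le_div_of_nonneg_right hK.ρ_le hpos.le
    · show g.σ / l ≤ g.β / l
      exact div_le_div_of_nonneg_right hK.σ_le hpos.le
    · show (g.ν / l) ^ 2 ≤ g.α / l * (g.β / l)
      rw [div_pow, div_mul_div_comm, div_le_div_iff₀ hl2 (by positivity)]
      calc g.ν ^ 2 * (l * l) ≤ g.α * g.β * (l * l) :=
            mul_le_mul_of_nonneg_right hK.c3 (by positivity)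
        _ = g.α * g.β * l ^ 2 := by ring
    · show (g.ρ / l + g.ν / l) ^ 2 ≤ g.α / l
      rw [← add_div, div_pow, div_le_div_iff₀ hl2 hpos]
      unfold Gen.u at hua
      calc (g.ρ + g.ν) ^ 2 * l ≤ g.α * l * l := mul_le_mul_of_nonneg_right hua hpos.le
        _ = g.α * l ^ 2 := by ring
    · show (g.σ / l + g.ν / l) ^ 2 ≤ g.β / l
      rw [← add_div, div_pow, div_le_div_iff₀ hl2 hpos]
      unfold Gen.v at hvb
      calc (g.σ + g.ν) ^ 2 * l ≤ g.β * l * l := mul_le_mul_of_nonneg_right hvb hpos.le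
        _ = g.β * l ^ 2 := by ring
  refine ⟨l, g', a, b, hpos, hle1, hK', ?_, ?_, ?_, ?_, ?_, ?_, ha0, ha1, hb0, hb1, hab,
    hu' ▸ hu_le, hv' ▸ hv_le, hg' ▸ hν_le, hg' ▸ hasq, hg' ▸ hbsq⟩
  · rw [hg']
    show g.ζ = (1 - l) + l * (1 - (g.ρ + g.σ + g.ν) / l)
    rw [mul_sub, mul_one, mul_div_cancel₀ _ hne']
    linarith
  · rw [hg']; exact (mul_div_cancel₀ _ hne').symm
  · rw [hg']; exact (mul_div_cancel₀ _ hne').symm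
  · rw [hg']; exact (mul_div_cancel₀ _ hne').symm
  · rw [hg']; exact (mul_div_cancel₀ _ hne').symm
  · rw [hg']; exact (mul_div_cancel₀ _ hne').symm

end ProdCS

end PercRepro
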